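import Summits.QuantumFields.QCD.Theses.QuarksAsStableAction
import Summits.QuantumFields.QCD.Theorems.QuarksAsStableActionDiamagnetismImpliesStability

/-!
# Route QuarksAsStableAction — Assembly (item stmt-QuantumFields-15410, formerly stmt-QuantumFields-9741)

The assembly of route `route-QuantumFields-QuarksAsStableAction` (sub-problem `QCD` of the summit
`QuantumFields`) is, since the restatement of 2026-08-16T15:37Z (the rev-0 text
`UnquenchedChessboardBound → WilsonQuarkStability → StableActionBridge → QCD` = stmt-9741 being a
propositional tautology, literally the deciding theorem `closes`), the SHARP closing path

`CriticalLineDiamagnetism → UnquenchedChessboardBound → StableActionBridge → QCD`.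

The bridge crux `StableActionBridge` is *by definition* the implication
`UnquenchedChessboardBound → WilsonQuarkStability → QCD`, and the sharp diamagnetic bound
`CriticalLineDiamagnetism` implies the stability bound `WilsonQuarkStability` by the landed support
`Theorems.diamagnetismImpliesStability_proof` (item `DiamagnetismImpliesStability`, `c₂ := −c₁`); so given
the diamagnetic bound `C`, the chessboard large-field bound `A` and the bridge `B`, the root-level
conjunct `QCD := QCDOf 2 ∧ QCDOf 3` follows by modus ponens:
`B A (diamagnetismImpliesStability_proof C)` — the planner's sketched term. No analysis, no named facts;
axioms ⊆ {propext, Classical.choice, Quot.sound}.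

The theorem keeps its name `quarksAsStableActionAssembly_proof`; its statement is literally the
(restated) route decl `Assembly` by name, and only the proof term changed (dependency-drift repair
2026-08-17: the rev-0 body `hB hA hS` mis-typed against the restated decl, full builds of 2026-08-16/17).

References: A. Jaffe, E. Witten, *Quantum Yang–Mills theory* (Clay problem description, 2000);
T. Kennedy, E. H. Lieb, *An itinerant electron model with crystalline or magnetic long range
order*, Physica A 138 (1986) — the scheme (integrate the fermions, keep reflection positivity and a
stability bound) behind the route; nothing from either is needed for this logical step.
-/

namespace Summit.QuantumFields.QCD.Theorems

open Summit.QuantumFields.QCD.Theses.QuarksAsStableAction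

/-- **Assembly of route QuarksAsStableAction** (item stmt-QuantumFields-15410):
`CriticalLineDiamagnetism → UnquenchedChessboardBound → StableActionBridge → QCD`.
Proof: `StableActionBridge` unfolds to `UnquenchedChessboardBound → WilsonQuarkStability → QCD`; the
stability bound comes from the diamagnetic bound by the landed support
`diamagnetismImpliesStability_proof`; apply the bridge (modus ponens, twice). [folklore] -/
theorem quarksAsStableActionAssembly_proof :
    Summit.QuantumFields.QCD.Theses.QuarksAsStableAction.Assembly := by
  unfold Summit.QuantumFields.QCD.Theses.QuarksAsStableAction.Assembly
  intro hC hA hB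
  exact hB hA (diamagnetismImpliesStability_proof hC)

end Summit.QuantumFields.QCD.Theorems
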